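import Literature.NumberTheory.LFunctions.BurnolZetaHardy
import Literature.NumberTheory.LFunctions.BurnolSonineHardyCharacterisationProofs
import Literature.NumberTheory.LFunctions.BurnolSonineHardy
import Literature.NumberTheory.LFunctions.BurnolEvaluatorProofs
import Literature.NumberTheory.LFunctions.BurnolZetaSystemsMinimal
import Literature.NumberTheory.LFunctions.SonineExtendedMellinContinuation
import Literature.NumberTheory.LFunctions.RiemannXiProofs
import HarnessLib

/-!
# Burnol 2004 (JTNB), Prop. 6.5: the shortened system of evaluators `Z¹_{ρ,k}` in `K_1` is MINIMAL —
# the dual vectors `s(s−1)ζ(s)/((s−ρ₁)(s−ρ₂)(s−ρ)^l) ∈ K̂_1`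

LINE 1 — LABEL: RH-FREE (Hilbert-space minimality of an evaluator system in de Branges' Sonine space
`K_1`, indexed by the non-trivial zeros of `ζ` WHEREVER they lie; no hypothesis and no conclusion about
their location). FRAMING (cell rh-crit, D-0074): corpus theorems are RH-FREE literature; nothing here is
worded as progress toward RH. bears_on: B-C/B-P (LADDER-RH COLUMN 6, de Branges framework). WHAT THIS
IS NOT: not a route, not a criterion, no positivity; minimality of Burnol's shortened system fixes corpus
vocabulary and moves RH by nothing. Nothing here bears on the truth of RH.

Source: J.-F. Burnol, *Two complete and minimal systems associated with the zeros of the Riemann zeta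
function*, J. Théor. Nombres Bordeaux 16 (2004) 65–94 = arXiv:math/0203120v7 [Burnol2004b], §6,
Prop. 6.5 (TeX of record `dbl/src/Burnol2004JTNB_arXivmath0203120v7.tex`, l.1303–1328):

> "The vectors `Z¹_{ρ,k}` are not minimal in `K_1`. In fact `K_1` is spanned by these vectors even
> after omitting `Z¹_{ρ₁,m_{ρ₁}−1}` and `Z¹_{ρ₂,m_{ρ₂}−1}` (`ρ₁ ≠ ρ₂`), or `Z¹_{ρ,m_ρ−1}` and
> `Z¹_{ρ,m_ρ−2}` (`m_ρ ≥ 2`), from the list. This shortened system is then a minimal system. […]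
> To prove minimality for the shortened system one only has to consider the functions
> `s(s−1)ζ(s)/((s−ρ₁)(s−ρ₂)) · 1/(s−ρ)^l` associated with the remaining zeros (and remaining
> multiplicities), as they are easily seen to be the right Mellin transforms of elements from the
> Sonine space `K_1`."

This theorem-only module (0 definitions, 0 named facts) PROVES the LAST clause of the typed named fact
`Burnol2004b_prop6_5` (`BurnolZetaSystems.lean`) as the free-standing theorem
`Burnol2004b_prop6_5_minimal : ∀ p q, IsAdmissibleOmission p q →
IsMinimalSystem (fun r : {r // r ≠ p ∧ r ≠ q} ↦ burnolZSystem 1 r.1)`, following the printed sentence: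

* **§A Division by linear factors** (`BurnolShortened.exists_eq_prod_mul`): an entire `F` with
  `ord_z F ≥ count_L z` is `∏_{z∈L}(s−z)·Q` with `Q` entire and `ord_z F = ord_z Q + count_L z`
  (removable singularities by Mathlib's `dslope`, `Complex.differentiableOn_dslope`).
* **§B `ℍ²`** (`BurnolShortened.isHardyRight_of_rational`): `(s−1)²ζ(s)/((s−z₁)(s−z₂)(s−z₃)^l) ∈ ℍ²` for
  three points of the open strip and `l ≥ 1`, as `F·φ` with `F = ((s−1)/s)ζ(s)/s ∈ ℍ²`
  (`BurnolZetaHardy.exists_isHardyRight_zeta_div`) and `φ = s²(s−1)/((s−z₁)(s−z₂)(s−z₃)^l)` bounded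
  off a rectangle (`IsHardyRight.of_le_off_rect'` — "if we exclude a neighborhood of `ρ` then … is
  bounded", the device of the printed proof of Prop. 4.2).
* **§C–D The transforms.** With `2ξ(s) = (s−ρ_p)(s−ρ_q)(s−ρ)^l·Q(s)` (§A applied to the entire `2ξ`,
  whose order at a point of the strip is the multiplicity `m(·)`, `analyticOrderAt_two_mul_riemannXi`),
  the entire functions `W = Q/Γ_ℝ` and `H(s) = Q(1−s)/Γ_ℝ(s)` are
  `W(s) = s(s−1)ζ(s)/((s−ρ_p)(s−ρ_q)(s−ρ)^l)` and `(−1)^l H(s)` = the same at the reflected zeros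
  `1−ρ_p, 1−ρ_q, 1−ρ` (`ξ(1−s) = ξ(s)`) off the bad points, with `Γ_ℝ(s)H(s) = Γ_ℝ(1−s)W(1−s)`.
* **§E The vectors `w ∈ K_1` with `ŵ = W`** (`BurnolShortened.exists_mem_sonineK`): by the repaired
  Prop. 4.1 (ii) — the Paley–Wiener door `Burnol2004b_prop4_1R_ii` (tree theorem) — from the two
  `ℍ²`-memberships and the functional equation; `K_1` (no pole at `1`) by
  `BurnolSonineHardy.mem_sonineK_of_continuousAt` and the functional equation on `L_1`
  (`SonineLContinuation.rightMellinExt_functionalEquation_of_mem_sonineL`); the pairings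
  `[w, Z¹_{ρ′,k}] = M(w)^{(k)}(ρ′) = Q^{(k)}(ρ′)` (`BurnolEvaluators.setIntegral_mul_burnolZ`).
* **§F–G The triangular pattern and the inversion**: `ord_{ρ′} Q = m(ρ′) − count` gives
  `[w_{ρ,l}, Z¹_{ρ′,k}] = 0` for remaining `(ρ′,k)` with `ρ′ ≠ ρ`, `= 0` for `k + l < m′_ρ` and `≠ 0` for
  `k + l = m′_ρ` (`m′_ρ` = number of remaining indices at `ρ`; Mathlib
  `analyticOrderAt_eq_nat_iff_iteratedDeriv_eq_zero`); minimality by the generic triangular inversion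
  `BurnolZetaMinimal.exists_dual_functional` and `exists_pairingCLM`, exactly as for Thm. 3.3 (ii)
  (`Burnol2004b_thm3_3_ii`).

NOT proved here: the first two clauses of `Burnol2004b_prop6_5` ("not minimal"; completeness of the
shortened system), whose printed proof (TeX l.1312–1321) is the annihilator-quotient argument of
Props. 6.1/6.2 at `a = 1` (Kreĭn's theorem in print).

## References
* [Burnol2004b] §6 Prop. 6.5 (TeX l.1303–1328); §4 Props. 4.1–4.2 (l.646–707); §2 (l.472–491).
* W. Rudin, *Real and Complex Analysis*, Ch. 19 (Hardy spaces of a half-plane). [folklore tools]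
-/

noncomputable section

open MeasureTheory Complex Filter Set
open scoped Topology FourierTransform

namespace Literature.NumberTheory.LFunctions

namespace BurnolShortened

/-! ## A. Division of an entire function by linear factors (removable singularities via `dslope`) -/

/-- The analytic order of `s ↦ s − a` at `z`: `1` at `z = a`, `0` elsewhere. [folklore] -/
private theorem analyticOrderAt_sub_const (a z : ℂ) :
    analyticOrderAt (fun s : ℂ ↦ s - a) z = if z = a then 1 else 0 := by
  have han : AnalyticAt ℂ (fun s : ℂ ↦ s - a) z := analyticAt_id.sub analyticAt_const
  split_ifs with h
  · subst h
    refine han.analyticOrderAt_eq_one_of_zero_deriv_ne_zero (by simp) ?_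
    rw [deriv_sub_const, deriv_id'']
    exact one_ne_zero
  · exact han.analyticOrderAt_eq_zero.2 (sub_ne_zero.2 h)

/-- One division step: an entire `F` vanishing at `a` is `(s − a) · Q` with `Q = dslope F a` entire, and the
analytic orders drop by one exactly at `a`. [folklore] -/
private theorem exists_eq_sub_mul_of_zero {F : ℂ → ℂ} (hF : Differentiable ℂ F) {a : ℂ} (ha : F a = 0) :
    ∃ Q : ℂ → ℂ, Differentiable ℂ Q ∧ (∀ s, F s = (s - a) * Q s) ∧
      ∀ z, analyticOrderAt F z = analyticOrderAt Q z + (if z = a then 1 else 0) := by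
  refine ⟨dslope F a, ?_, fun s ↦ ?_, fun z ↦ ?_⟩
  · have h := (Complex.differentiableOn_dslope (f := F) (s := univ) (c := a) Filter.univ_mem).2
      hF.differentiableOn
    exact differentiableOn_univ.1 h
  · have h := sub_smul_dslope F a s
    rw [ha, sub_zero, smul_eq_mul] at h
    exact h.symm
  · have hQ : Differentiable ℂ (dslope F a) := differentiableOn_univ.1
      ((Complex.differentiableOn_dslope (f := F) (s := univ) (c := a) Filter.univ_mem).2
        hF.differentiableOn)
    have heq : F = (fun s : ℂ ↦ s - a) * dslope F a := by
      funext s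
      have h := sub_smul_dslope F a s
      rw [ha, sub_zero, smul_eq_mul] at h
      rw [Pi.mul_apply]
      exact h.symm
    have hlin : AnalyticAt ℂ (fun s : ℂ ↦ s - a) z := analyticAt_id.sub analyticAt_const
    conv_lhs => rw [heq]
    rw [analyticOrderAt_mul (f := fun s : ℂ ↦ s - a) (g := dslope F a) hlin (hQ.analyticAt z),
      analyticOrderAt_sub_const, add_comm]

/-- **Division by linear factors.** An entire `F` whose order of vanishing at each `z` is at least the
multiplicity of `z` in the list `L` is `(∏_{z ∈ L} (s − z)) · Q` with `Q` entire, and the orders satisfy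
`ord_z F = ord_z Q + count_L z`. [folklore] -/
private theorem exists_eq_prod_mul (F : ℂ → ℂ) (hF : Differentiable ℂ F) (L : List ℂ)
    (hL : ∀ z, (L.count z : ℕ∞) ≤ analyticOrderAt F z) :
    ∃ Q : ℂ → ℂ, Differentiable ℂ Q ∧ (∀ s, F s = (L.map fun z ↦ s - z).prod * Q s) ∧
      ∀ z, analyticOrderAt F z = analyticOrderAt Q z + L.count z := by
  classical
  induction L generalizing F with
  | nil => exact ⟨F, hF, fun s ↦ by simp, fun z ↦ by simp⟩
  | cons a L ih =>
    -- `F` vanishes at `a`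
    have ha1 : (1 : ℕ∞) ≤ analyticOrderAt F a := by
      refine le_trans ?_ (hL a)
      exact_mod_cast (show 1 ≤ (a :: L).count a by simp)
    have hFa : F a = 0 := by
      have h := (hF.analyticAt a).analyticOrderAt_ne_zero
      by_contra hne
      have h0 : analyticOrderAt F a = 0 := (hF.analyticAt a).analyticOrderAt_eq_zero.2 hne
      rw [h0] at ha1
      exact absurd ha1 (by norm_num)
    obtain ⟨Q₁, hQ₁, hFQ₁, hord₁⟩ := exists_eq_sub_mul_of_zero hF hFa
    -- the remaining multiplicities are bounded by the orders of `Q₁`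
    have hL' : ∀ z, (L.count z : ℕ∞) ≤ analyticOrderAt Q₁ z := by
      intro z
      have h := hL z
      rw [hord₁ z, List.count_cons] at h
      by_cases hz : z = a
      · subst hz
        simp only [beq_self_eq_true, if_true, Nat.cast_add, Nat.cast_one] at h
        exact (WithTop.add_le_add_iff_right WithTop.one_ne_top).1 h
      · have hz' : (a == z) = false := by simpa using (Ne.symm hz)
        simp only [hz', if_false, hz, add_zero, Bool.false_eq_true] at h
        simpa using h
    obtain ⟨Q, hQ, hQ₁Q, hord⟩ := ih Q₁ hQ₁ hL'
    refine ⟨Q, hQ, fun s ↦ ?_, fun z ↦ ?_⟩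
    · rw [hFQ₁ s, hQ₁Q s, List.map_cons, List.prod_cons, mul_assoc]
    · rw [hord₁ z, hord z, List.count_cons, add_assoc]
      congr 1
      by_cases hz : z = a
      · subst hz; simp
      · have hz' : (a == z) = false := by simpa using (Ne.symm hz)
        simp [hz', hz]

/-! ## B. `ℍ²`-membership of `(s−1)²ζ(s)/((s−z₁)(s−z₂)(s−z₃)^l)` (rational multiples of `((s−1)/s)ζ(s)/s`) -/

/-- Separation from a point of the open strip off a rectangle around it. [folklore] -/
private theorem le_norm_sub_of_off_rect {z : ℂ} (hz0 : 0 < z.re) (hz1 : z.re < 1) {σ₁ σ₂ R d : ℝ}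
    (hσ₁ : σ₁ ≤ z.re / 2) (hσ₂ : (z.re + 1) / 2 ≤ σ₂) (hR : |z.im| + 1 ≤ R) (hd1 : d ≤ z.re / 2)
    (hd2 : d ≤ (1 - z.re) / 2) {s : ℂ}
    (hs : s.re < σ₁ ∨ σ₂ < s.re ∨ R < |s.im|) : d ≤ ‖s - z‖ := by
  have hre : |(s - z).re| ≤ ‖s - z‖ := Complex.abs_re_le_norm _
  have him : |(s - z).im| ≤ ‖s - z‖ := Complex.abs_im_le_norm _
  rw [Complex.sub_re] at hre
  rw [Complex.sub_im] at him
  rcases hs with h | h | h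
  · have : z.re / 2 ≤ |s.re - z.re| := by
      rw [abs_sub_comm, abs_of_nonneg (by linarith)]; linarith
    linarith
  · have : (1 - z.re) / 2 ≤ |s.re - z.re| := by
      rw [abs_of_nonneg (by linarith)]; linarith
    linarith
  · have : 1 ≤ |s.im - z.im| := by
      have := abs_sub_abs_le_abs_sub s.im z.im
      linarith
    linarith

/-- `‖(s − b)/(s − z)‖ ≤ 1 + ‖z − b‖/d` when `‖s − z‖ ≥ d > 0`. [folklore] -/
private theorem norm_sub_div_sub_le {s z b : ℂ} {d : ℝ} (hd : 0 < d) (hsz : d ≤ ‖s - z‖) :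
    ‖(s - b) / (s - z)‖ ≤ 1 + ‖z - b‖ / d := by
  have hsz0 : s - z ≠ 0 := fun h ↦ by rw [h, norm_zero] at hsz; linarith
  have hsplit : (s - b) / (s - z) = 1 + (z - b) / (s - z) := by
    field_simp
    ring
  rw [hsplit]
  calc ‖1 + (z - b) / (s - z)‖ ≤ ‖(1 : ℂ)‖ + ‖(z - b) / (s - z)‖ := norm_add_le _ _
    _ = 1 + ‖z - b‖ / ‖s - z‖ := by rw [norm_one, norm_div]
    _ ≤ 1 + ‖z - b‖ / d := by gcongr

/-- **Rational multiples of `((s−1)/s)ζ(s)/s` off three zeros of the strip.** Let `F ∈ ℍ²` agree with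
`((s−1)/s)ζ(s)/s` on `Re s > 1/2`, `s ≠ 1` (`BurnolZetaHardy.exists_isHardyRight_zeta_div`), and let `G` be
holomorphic on `Re s > 1/2`, continuous on `Re s > 0`, with `G(1) = 0` and
`G(s) = (s−1)²ζ(s)/((s−z₁)(s−z₂)(s−z₃)^l)` off `{1, z₁, z₂, z₃}`, where `z₁, z₂, z₃` lie in the open strip
and `l ≥ 1`. Then `G ∈ ℍ²`: off a compact rectangle around the `zᵢ` (avoiding `0` and `1`) the factor
`s²(s−1)/((s−z₁)(s−z₂)(s−z₃)^l)` is bounded ("if we exclude a neighborhood of `ρ` then … is bounded"),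
and on it `G` is bounded by continuity (`IsHardyRight.of_le_off_rect'`).
[cite: Burnol2004b, Prop. 4.2 proof and Prop. 6.5 proof (arXiv:math/0203120v7 pp. 8, 16; TeX l.695–707, 1322–1328)] -/
theorem isHardyRight_of_rational {F G : ℂ → ℂ} (hF : IsHardyRight F)
    (hFeq : ∀ s : ℂ, 1 / 2 < s.re → s ≠ 1 → F s = (s - 1) / s * (riemannZeta s / s))
    (hG : DifferentiableOn ℂ G {s | 1 / 2 < s.re}) (hGc : ContinuousOn G {s | 0 < s.re})
    (hG1 : G 1 = 0) {z₁ z₂ z₃ : ℂ} (h₁ : 0 < z₁.re ∧ z₁.re < 1) (h₂ : 0 < z₂.re ∧ z₂.re < 1)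
    (h₃ : 0 < z₃.re ∧ z₃.re < 1) {l : ℕ} (hl : 1 ≤ l)
    (hGeq : ∀ s : ℂ, 1 / 2 < s.re → s ≠ 1 → s ≠ z₁ → s ≠ z₂ → s ≠ z₃ →
      G s = (s - 1) ^ 2 * riemannZeta s / ((s - z₁) * (s - z₂) * (s - z₃) ^ l)) :
    IsHardyRight G := by
  -- the rectangle around the three points, avoiding `0` and `1`
  set σ₁ : ℝ := min (min z₁.re z₂.re) z₃.re / 2 with hσ₁
  set σ₂ : ℝ := (max (max z₁.re z₂.re) z₃.re + 1) / 2 with hσ₂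
  set R : ℝ := max (max |z₁.im| |z₂.im|) |z₃.im| + 1 with hR
  set d : ℝ := min (min (min (min z₁.re z₂.re) z₃.re / 2)
    ((1 - max (max z₁.re z₂.re) z₃.re) / 2)) 1 with hd
  have hd0 : 0 < d := by
    rw [hd]
    refine lt_min (lt_min ?_ ?_) one_pos
    · have : 0 < min (min z₁.re z₂.re) z₃.re := lt_min (lt_min h₁.1 h₂.1) h₃.1
      linarith
    · have : max (max z₁.re z₂.re) z₃.re < 1 := max_lt (max_lt h₁.2 h₂.2) h₃.2
      linarith
  have hR0 : 0 ≤ R := by rw [hR]; positivity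
  have hσ₁pos : 0 < σ₁ := by
    rw [hσ₁]; have : 0 < min (min z₁.re z₂.re) z₃.re := lt_min (lt_min h₁.1 h₂.1) h₃.1; linarith
  have hσ₂lt : σ₂ < 1 := by
    rw [hσ₂]; have : max (max z₁.re z₂.re) z₃.re < 1 := max_lt (max_lt h₁.2 h₂.2) h₃.2; linarith
  -- separation data for each of the three points
  have hmin1 : min (min z₁.re z₂.re) z₃.re ≤ z₁.re := (min_le_left _ _).trans (min_le_left _ _)
  have hmin2 : min (min z₁.re z₂.re) z₃.re ≤ z₂.re := (min_le_left _ _).trans (min_le_right _ _)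
  have hmin3 : min (min z₁.re z₂.re) z₃.re ≤ z₃.re := min_le_right _ _
  have hmax1 : z₁.re ≤ max (max z₁.re z₂.re) z₃.re := (le_max_left _ _).trans (le_max_left _ _)
  have hmax2 : z₂.re ≤ max (max z₁.re z₂.re) z₃.re := (le_max_right _ _).trans (le_max_left _ _)
  have hmax3 : z₃.re ≤ max (max z₁.re z₂.re) z₃.re := le_max_right _ _
  have hRi1 : |z₁.im| ≤ max (max |z₁.im| |z₂.im|) |z₃.im| := (le_max_left _ _).trans (le_max_left _ _)
  have hRi2 : |z₂.im| ≤ max (max |z₁.im| |z₂.im|) |z₃.im| := (le_max_right _ _).trans (le_max_left _ _)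
  have hRi3 : |z₃.im| ≤ max (max |z₁.im| |z₂.im|) |z₃.im| := le_max_right _ _
  have hdA : d ≤ min (min z₁.re z₂.re) z₃.re / 2 := (min_le_left _ _).trans (min_le_left _ _)
  have hdB : d ≤ (1 - max (max z₁.re z₂.re) z₃.re) / 2 := (min_le_left _ _).trans (min_le_right _ _)
  have hfar : ∀ s : ℂ, (s.re < σ₁ ∨ σ₂ < s.re ∨ R < |s.im|) →
      d ≤ ‖s - z₁‖ ∧ d ≤ ‖s - z₂‖ ∧ d ≤ ‖s - z₃‖ := by
    intro s hs
    refine ⟨le_norm_sub_of_off_rect h₁.1 h₁.2 ?_ ?_ ?_ ?_ ?_ hs,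
      le_norm_sub_of_off_rect h₂.1 h₂.2 ?_ ?_ ?_ ?_ ?_ hs,
      le_norm_sub_of_off_rect h₃.1 h₃.2 ?_ ?_ ?_ ?_ ?_ hs⟩
    all_goals first
      | (rw [hσ₁]; linarith)
      | (rw [hσ₂]; linarith)
      | (rw [hR]; linarith)
      | linarith
  -- the constant
  set C : ℝ := (1 + ‖z₁ - 0‖ / d) * (1 + ‖z₂ - 0‖ / d) * (1 + ‖z₃ - 1‖ / d) * (1 / d) ^ (l - 1)
    with hC
  have hC0 : 0 ≤ C := by rw [hC]; positivity
  -- bound on the compact rectangle from continuity on `Re s > 0`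
  set K : Set ℂ := Set.Icc σ₁ σ₂ ×ℂ Set.Icc (-R) R with hK
  have hKc : IsCompact K := isCompact_Icc.reProdIm isCompact_Icc
  have hKsub : K ⊆ {s : ℂ | 0 < s.re} := by
    intro s hs
    obtain ⟨⟨h1, -⟩, -⟩ := Complex.mem_reProdIm.1 hs
    exact lt_of_lt_of_le hσ₁pos h1
  obtain ⟨M₀, hM₀⟩ := hKc.exists_bound_of_continuousOn (hGc.mono hKsub)
  have hMK : ∀ s : ℂ, 1 / 2 < s.re → σ₁ ≤ s.re → s.re ≤ σ₂ → |s.im| ≤ R →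
      ‖G s‖ ≤ max M₀ 0 := by
    intro s _ h1 h2 h3
    exact (hM₀ s (Complex.mem_reProdIm.2 ⟨⟨h1, h2⟩, abs_le.1 h3⟩)).trans (le_max_left _ _)
  -- off the rectangle: `G = F · s²(s−1)/((s−z₁)(s−z₂)(s−z₃)^l)` with a bounded second factor
  have hb : ∀ s : ℂ, 1 / 2 < s.re → (s.re < σ₁ ∨ σ₂ < s.re ∨ R < |s.im|) →
      ‖G s‖ ≤ C * ‖F s‖ := by
    intro s hs hout
    by_cases hs1 : s = 1
    · rw [hs1, hG1, norm_zero]; positivity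
    obtain ⟨hd₁, hd₂, hd₃⟩ := hfar s hout
    have hs0 : s ≠ 0 := fun h ↦ by rw [h, Complex.zero_re] at hs; linarith
    have hne : ∀ {z : ℂ}, d ≤ ‖s - z‖ → s ≠ z := fun h e ↦ by
      rw [e, sub_self, norm_zero] at h; linarith
    have hz₁ : s - z₁ ≠ 0 := sub_ne_zero.2 (hne hd₁)
    have hz₂ : s - z₂ ≠ 0 := sub_ne_zero.2 (hne hd₂)
    have hz₃ : s - z₃ ≠ 0 := sub_ne_zero.2 (hne hd₃)
    -- the factorisation
    have hfac : G s = F s * ((s - 0) / (s - z₁) * ((s - 0) / (s - z₂)) * ((s - 1) / (s - z₃)) *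
        (1 / (s - z₃) ^ (l - 1))) := by
      rw [hGeq s hs hs1 (hne hd₁) (hne hd₂) (hne hd₃), hFeq s hs hs1, sub_zero]
      obtain ⟨l', rfl⟩ : ∃ l', l = l' + 1 := ⟨l - 1, by omega⟩
      simp only [Nat.add_sub_cancel, pow_succ]
      field_simp
    rw [hfac, norm_mul, mul_comm]
    refine mul_le_mul_of_nonneg_right ?_ (norm_nonneg _)
    rw [norm_mul, norm_mul, norm_mul, hC]
    have e1 : ‖(s - 0) / (s - z₁)‖ ≤ 1 + ‖z₁ - 0‖ / d := norm_sub_div_sub_le hd0 hd₁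
    have e2 : ‖(s - 0) / (s - z₂)‖ ≤ 1 + ‖z₂ - 0‖ / d := norm_sub_div_sub_le hd0 hd₂
    have e3 : ‖(s - 1) / (s - z₃)‖ ≤ 1 + ‖z₃ - 1‖ / d := norm_sub_div_sub_le hd0 hd₃
    have e4 : ‖1 / (s - z₃) ^ (l - 1)‖ ≤ (1 / d) ^ (l - 1) := by
      rw [norm_div, norm_one, norm_pow, ← one_div_pow]
      exact pow_le_pow_left₀ (by positivity) (one_div_le_one_div_of_le hd0 hd₃) _
    gcongr
  exact hF.of_le_off_rect' hG hR0 hC0 (le_max_right M₀ 0) hMK hb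

/-! ## C. Orders of `ξ` at the points of the critical strip -/

/-- `ξ` is entire and not identically zero, so its order of vanishing at every point is finite
(re-derivation of `SuzukiUncertainty.analyticOrderAt_riemannXi_ne_top`, to keep imports light).
[cite: Burnol2004b, §2 (arXiv:math/0203120v7 p. 5, TeX l.437–443)] -/
private theorem analyticOrderAt_riemannXi_ne_top' (s : ℂ) : analyticOrderAt riemannXi s ≠ ⊤ := by
  intro htop
  have h0 : riemannXi 0 = 0 :=
    AnalyticOnNhd.eqOn_zero_of_preconnected_of_eventuallyEq_zero (f := riemannXi) (U := univ)
      (fun z _ ↦ differentiable_riemannXi.analyticAt z) isPreconnected_univ (mem_univ s)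
      (analyticOrderAt_eq_top.mp htop) (mem_univ 0)
  rw [riemannXi_zero] at h0
  norm_num at h0

/-- In the critical strip the multiplicity `m(ρ)` of `ρ` as a zero of `ζ` (`riemannZetaZeroOrder`) is its
order as a zero of `ξ = ½s(s−1)Γ_ℝ(s)ζ(s)` (non-vanishing analytic cofactor); re-derivation of
`SuzukiUncertainty.riemannZetaZeroOrder_eq_analyticOrderNatAt_riemannXi`, to keep imports light.
[cite: Burnol2004b, §2 (arXiv:math/0203120v7 p. 5, TeX l.486–491)] -/
private theorem riemannZetaZeroOrder_eq_analyticOrderNatAt_riemannXi' {ρ : ℂ} (h0 : 0 < ρ.re)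
    (h1 : ρ.re < 1) : riemannZetaZeroOrder ρ = (analyticOrderNatAt riemannXi ρ : ℤ) := by
  have hρ0 : ρ ≠ 0 := fun h ↦ by simp [h] at h0
  have hρ1 : ρ ≠ 1 := fun h ↦ by simp [h] at h1
  set u : ℂ → ℂ := fun s ↦ 2 / (s * (s - 1)) * (Gammaℝ s)⁻¹ with hu
  have hu_an : AnalyticAt ℂ u ρ := by
    have h2 : AnalyticAt ℂ (fun s : ℂ ↦ 2 / (s * (s - 1))) ρ := by
      apply AnalyticAt.div analyticAt_const (by fun_prop)
      exact mul_ne_zero hρ0 (sub_ne_zero.mpr hρ1)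
    exact h2.mul (differentiable_Gammaℝ_inv.analyticAt ρ)
  have hu_ne : u ρ ≠ 0 := by
    simp only [u]
    refine mul_ne_zero (div_ne_zero two_ne_zero (mul_ne_zero hρ0 (sub_ne_zero.mpr hρ1))) ?_
    exact inv_ne_zero (Gammaℝ_ne_zero_of_re_pos h0)
  have hU : ∀ᶠ s in 𝓝 ρ, s ≠ 0 ∧ s ≠ 1 := (isOpen_ne.inter isOpen_ne).mem_nhds ⟨hρ0, hρ1⟩
  have heq : (riemannXi * u) =ᶠ[𝓝 ρ] riemannZeta := by
    filter_upwards [hU] with s hs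
    have hss : s * (s - 1) ≠ 0 := mul_ne_zero hs.1 (sub_ne_zero.mpr hs.2)
    have hc : s * (s - 1) / 2 * (2 / (s * (s - 1))) = 1 := by
      rw [div_mul_div_comm, mul_comm (s * (s - 1)) 2, div_self (mul_ne_zero two_ne_zero hss)]
    calc (riemannXi * u) s
        = (s * (s - 1) / 2 * (2 / (s * (s - 1)))) * (completedRiemannZeta s * (Gammaℝ s)⁻¹) := by
          rw [Pi.mul_apply, riemannXi_eq_mul_completedRiemannZeta hs.1 hs.2]; simp only [u]; ring
      _ = riemannZeta s := by rw [hc, one_mul, riemannZeta_def_of_ne_zero hs.1, div_eq_mul_inv]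
  have hord : analyticOrderAt riemannZeta ρ = analyticOrderAt riemannXi ρ := by
    rw [← analyticOrderAt_congr heq,
      analyticOrderAt_mul ((differentiable_riemannXi).analyticAt ρ) hu_an,
      (hu_an.analyticOrderAt_eq_zero).mpr hu_ne, add_zero]
  have hζa : AnalyticAt ℂ riemannZeta ρ := analyticOn_riemannZeta ρ hρ1
  obtain ⟨n, hn⟩ := ENat.ne_top_iff_exists.mp (analyticOrderAt_riemannXi_ne_top' ρ)
  rw [riemannZetaZeroOrder, hζa.meromorphicOrderAt_eq, hord, ← hn, analyticOrderNatAt, ← hn]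
  simp

/-- **The order of `2ξ` at a point `ρ` of the open critical strip is `m(ρ)`** (the multiplicity of `ρ` as a
zero of `ζ`, as a natural number; `0` off the zeros). [cite: Burnol2004b, §2 and Note 5 (arXiv:math/0203120v7 pp. 5, 11; TeX l.486–491, 978–984)] -/
theorem analyticOrderAt_two_mul_riemannXi {ρ : ℂ} (h0 : 0 < ρ.re) (h1 : ρ.re < 1) :
    analyticOrderAt (fun s ↦ 2 * riemannXi s) ρ = ((riemannZetaZeroOrder ρ).toNat : ℕ∞) := by
  have h2 : AnalyticAt ℂ (fun _ : ℂ ↦ (2 : ℂ)) ρ := analyticAt_const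
  have hprod : (fun s ↦ 2 * riemannXi s) = (fun _ : ℂ ↦ (2 : ℂ)) * riemannXi := rfl
  rw [hprod, analyticOrderAt_mul h2 (differentiable_riemannXi.analyticAt ρ),
    h2.analyticOrderAt_eq_zero.2 two_ne_zero, zero_add,
    riemannZetaZeroOrder_eq_analyticOrderNatAt_riemannXi' h0 h1, Int.toNat_natCast,
    Nat.cast_analyticOrderNatAt (analyticOrderAt_riemannXi_ne_top' ρ)]

/-- The differentiability of `2ξ`. [cite: Burnol2004b, §2 (arXiv:math/0203120v7 p. 5, TeX l.437–443)] -/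
theorem differentiable_two_mul_riemannXi : Differentiable ℂ (fun s ↦ 2 * riemannXi s) :=
  (differentiable_const _).mul differentiable_riemannXi

/-! ## D. The functions `W = Q/Γ_ℝ` and their Fourier partners `H` -/

section WFun

variable {z₁ z₂ z₃ : ℂ} {l : ℕ} {Q W H : ℂ → ℂ}

/-- `W = Q/Γ_ℝ` is entire (`1/Γ_ℝ` is entire). [cite: Burnol2004b, Prop. 6.5 proof (arXiv:math/0203120v7 p. 16, TeX l.1322–1328)] -/
theorem differentiable_of_eq_mul_Gammaℝ_inv (hQ : Differentiable ℂ Q)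
    (hW : ∀ s, W s = Q s * (Gammaℝ s)⁻¹) : Differentiable ℂ W := by
  have : W = fun s ↦ Q s * (Gammaℝ s)⁻¹ := funext hW
  rw [this]
  exact hQ.mul differentiable_Gammaℝ_inv

/-- `H(s) = Q(1−s)/Γ_ℝ(s)` is entire. [cite: Burnol2004b, Prop. 6.5 proof (arXiv:math/0203120v7 p. 16, TeX l.1322–1328)] -/
theorem differentiable_of_eq_comp_mul_Gammaℝ_inv (hQ : Differentiable ℂ Q)
    (hH : ∀ s, H s = Q (1 - s) * (Gammaℝ s)⁻¹) : Differentiable ℂ H := by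
  have : H = fun s ↦ Q (1 - s) * (Gammaℝ s)⁻¹ := funext hH
  rw [this]
  exact (hQ.comp ((differentiable_const _).sub differentiable_id)).mul differentiable_Gammaℝ_inv

/-- `2ξ(s)/Γ_ℝ(s) = s(s−1)ζ(s)` for `s ≠ 0, 1` with `Γ_ℝ(s) ≠ 0`. [cite: Burnol2004b, §2 (arXiv:math/0203120v7 p. 5, TeX l.437–443)] -/
theorem two_mul_riemannXi_mul_Gammaℝ_inv {s : ℂ} (hs0 : s ≠ 0) (hs1 : s ≠ 1) (hΓ : Gammaℝ s ≠ 0) :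
    2 * riemannXi s * (Gammaℝ s)⁻¹ = s * (s - 1) * riemannZeta s := by
  rw [riemannXi_eq_mul_completedRiemannZeta hs0 hs1, riemannZeta_def_of_ne_zero hs0]
  field_simp

/-- **The explicit form of `W`**: off `0, 1`, the poles of `Γ_ℝ` and the three roots,
`W(s) = s(s−1)ζ(s)/((s−z₁)(s−z₂)(s−z₃)^l)` when `2ξ = (s−z₁)(s−z₂)(s−z₃)^l · Q`.
[cite: Burnol2004b, Prop. 6.5 proof (arXiv:math/0203120v7 p. 16, TeX l.1322–1328)] -/
theorem W_eq (hQeq : ∀ s, 2 * riemannXi s = (s - z₁) * (s - z₂) * (s - z₃) ^ l * Q s)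
    (hW : ∀ s, W s = Q s * (Gammaℝ s)⁻¹) {s : ℂ} (hs0 : s ≠ 0) (hs1 : s ≠ 1) (hΓ : Gammaℝ s ≠ 0)
    (h₁ : s ≠ z₁) (h₂ : s ≠ z₂) (h₃ : s ≠ z₃) :
    W s = s * (s - 1) * riemannZeta s / ((s - z₁) * (s - z₂) * (s - z₃) ^ l) := by
  have hP : (s - z₁) * (s - z₂) * (s - z₃) ^ l ≠ 0 :=
    mul_ne_zero (mul_ne_zero (sub_ne_zero.2 h₁) (sub_ne_zero.2 h₂)) (pow_ne_zero _ (sub_ne_zero.2 h₃))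
  have hQs : Q s = 2 * riemannXi s / ((s - z₁) * (s - z₂) * (s - z₃) ^ l) := by
    rw [hQeq s]; field_simp
  rw [hW s, hQs, div_mul_eq_mul_div, two_mul_riemannXi_mul_Gammaℝ_inv hs0 hs1 hΓ]

/-- **The explicit form of `H`**: `H(s) = (−1)^l s(s−1)ζ(s)/((s−(1−z₁))(s−(1−z₂))(s−(1−z₃))^l)` off the
bad points (via `ξ(1−s) = ξ(s)`). [cite: Burnol2004b, Prop. 6.5 proof and Prop. 4.2 proof (arXiv:math/0203120v7 pp. 8, 16; TeX l.695–698, 1322–1328)] -/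
theorem H_eq (hQeq : ∀ s, 2 * riemannXi s = (s - z₁) * (s - z₂) * (s - z₃) ^ l * Q s)
    (hH : ∀ s, H s = Q (1 - s) * (Gammaℝ s)⁻¹) {s : ℂ} (hs0 : s ≠ 0) (hs1 : s ≠ 1)
    (hΓ : Gammaℝ s ≠ 0) (h₁ : s ≠ 1 - z₁) (h₂ : s ≠ 1 - z₂) (h₃ : s ≠ 1 - z₃) :
    (-1) ^ l * H s =
      s * (s - 1) * riemannZeta s / ((s - (1 - z₁)) * (s - (1 - z₂)) * (s - (1 - z₃)) ^ l) := by
  have h₁' : 1 - s - z₁ ≠ 0 := fun h ↦ h₁ (by linear_combination (-1 : ℂ) * h)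
  have h₂' : 1 - s - z₂ ≠ 0 := fun h ↦ h₂ (by linear_combination (-1 : ℂ) * h)
  have h₃' : 1 - s - z₃ ≠ 0 := fun h ↦ h₃ (by linear_combination (-1 : ℂ) * h)
  have hP : (1 - s - z₁) * (1 - s - z₂) * (1 - s - z₃) ^ l ≠ 0 :=
    mul_ne_zero (mul_ne_zero h₁' h₂') (pow_ne_zero _ h₃')
  have hQs : Q (1 - s) = 2 * riemannXi s / ((1 - s - z₁) * (1 - s - z₂) * (1 - s - z₃) ^ l) := by
    have h := hQeq (1 - s)
    rw [riemannXi_one_sub] at h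
    rw [h]; field_simp
  have hkey : 2 * riemannXi s * (Gammaℝ s)⁻¹ = s * (s - 1) * riemannZeta s :=
    two_mul_riemannXi_mul_Gammaℝ_inv hs0 hs1 hΓ
  have hw₁ : s - (1 - z₁) ≠ 0 := sub_ne_zero.2 h₁
  have hw₂ : s - (1 - z₂) ≠ 0 := sub_ne_zero.2 h₂
  have hw₃ : s - (1 - z₃) ≠ 0 := sub_ne_zero.2 h₃
  have hden : (1 - s - z₁) * (1 - s - z₂) * (1 - s - z₃) ^ l =
      (-1) ^ l * ((s - (1 - z₁)) * (s - (1 - z₂)) * (s - (1 - z₃)) ^ l) := by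
    have e3 : 1 - s - z₃ = -(s - (1 - z₃)) := by ring
    rw [e3, neg_pow]; ring
  have hm1 : ((-1 : ℂ)) ^ l ≠ 0 := pow_ne_zero _ (by norm_num)
  calc (-1) ^ l * H s = (-1) ^ l * (2 * riemannXi s * (Gammaℝ s)⁻¹) /
        ((-1) ^ l * ((s - (1 - z₁)) * (s - (1 - z₂)) * (s - (1 - z₃)) ^ l)) := by
          rw [hH s, hQs, hden]; ring
    _ = s * (s - 1) * riemannZeta s / ((s - (1 - z₁)) * (s - (1 - z₂)) * (s - (1 - z₃)) ^ l) := by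
          rw [hkey, mul_div_mul_left _ _ hm1]

/-- **The functional equation** `Γ_ℝ(s)H(s) = Γ_ℝ(1−s)W(1−s)` off the poles of the two Gamma factors
(both sides equal `Q(1−s)`). [cite: Burnol2004b, Prop. 4.1 (arXiv:math/0203120v7 p. 8, TeX l.646–669)] -/
theorem Gammaℝ_mul_H_eq (hW : ∀ s, W s = Q s * (Gammaℝ s)⁻¹) (hH : ∀ s, H s = Q (1 - s) * (Gammaℝ s)⁻¹)
    (s : ℂ) (hs0 : ∀ n : ℕ, s ≠ -2 * (n : ℂ)) (hs1 : ∀ n : ℕ, s ≠ 1 + 2 * (n : ℂ)) :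
    Gammaℝ s * H s = Gammaℝ (1 - s) * W (1 - s) := by
  have hΓ : Gammaℝ s ≠ 0 := by
    rw [Ne, Gammaℝ_eq_zero_iff]
    rintro ⟨n, hn⟩
    exact hs0 n (by rw [hn]; ring)
  have hΓ' : Gammaℝ (1 - s) ≠ 0 := by
    rw [Ne, Gammaℝ_eq_zero_iff]
    rintro ⟨n, hn⟩
    exact hs1 n (by linear_combination (-1 : ℂ) * hn)
  rw [hH s, hW (1 - s)]
  field_simp

end WFun

/-! ## E. The vectors `w_{ρ,l} ∈ K_1` with `ŵ = W` and their pairings with the evaluators -/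

section Vectors

variable {z₁ z₂ z₃ : ℂ} {l : ℕ} {Q : ℂ → ℂ}

/-- `s ↦ (s−1)/s · E(s)` is holomorphic off `s = 0` for an entire `E`. [folklore] -/
private theorem differentiableOn_normalised {E : ℂ → ℂ} (hE : Differentiable ℂ E) {U : Set ℂ}
    (hU : U ⊆ {s | s ≠ 0}) : DifferentiableOn ℂ (fun s : ℂ ↦ (s - 1) / s * E s) U := by
  intro s hs
  exact (((differentiableAt_id.sub_const 1).div differentiableAt_id (hU hs)).mul
    (hE s)).differentiableWithinAt

/-- **`((s−1)/s)·W ∈ ℍ²`** for `W = Q/Γ_ℝ`, `2ξ = (s−z₁)(s−z₂)(s−z₃)^l·Q`, roots in the open strip, `l ≥ 1`.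
[cite: Burnol2004b, Prop. 6.5 proof (arXiv:math/0203120v7 p. 16, TeX l.1322–1328)] -/
theorem exists_isHardyRight_W (hQ : Differentiable ℂ Q)
    (hQeq : ∀ s, 2 * riemannXi s = (s - z₁) * (s - z₂) * (s - z₃) ^ l * Q s)
    (h₁ : 0 < z₁.re ∧ z₁.re < 1) (h₂ : 0 < z₂.re ∧ z₂.re < 1) (h₃ : 0 < z₃.re ∧ z₃.re < 1)
    (hl : 1 ≤ l) :
    ∃ F : ℂ → ℂ, IsHardyRight F ∧ ∀ s : ℂ, 1 / 2 < s.re → s ≠ 1 →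
      F s = ((1 : ℝ) : ℂ) ^ s * ((s - 1) / s) * (Q s * (Gammaℝ s)⁻¹) := by
  obtain ⟨F, hF, hFeq⟩ := BurnolZetaHardy.exists_isHardyRight_zeta_div
  have hWd : Differentiable ℂ (fun s ↦ Q s * (Gammaℝ s)⁻¹) := hQ.mul differentiable_Gammaℝ_inv
  refine ⟨fun s ↦ (s - 1) / s * (Q s * (Gammaℝ s)⁻¹), ?_, fun s hs hs1 ↦ by
    push_cast; rw [one_cpow, one_mul]⟩
  refine isHardyRight_of_rational hF hFeq (differentiableOn_normalised hWd fun s hs h ↦ by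
      rw [h] at hs; norm_num at hs)
    ((differentiableOn_normalised hWd fun s hs h ↦ by
      rw [h] at hs; norm_num at hs).continuousOn)
    (by simp) h₁ h₂ h₃ hl fun s hs hs1 hz₁ hz₂ hz₃ ↦ ?_
  have hs0 : s ≠ 0 := fun h ↦ by rw [h, Complex.zero_re] at hs; norm_num at hs
  have hΓ : Gammaℝ s ≠ 0 := Gammaℝ_ne_zero_of_re_pos (by linarith)
  show (s - 1) / s * (Q s * (Gammaℝ s)⁻¹) = _
  rw [W_eq (W := fun s ↦ Q s * (Gammaℝ s)⁻¹) hQeq (fun _ ↦ rfl) hs0 hs1 hΓ hz₁ hz₂ hz₃]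
  have hP : (s - z₁) * (s - z₂) * (s - z₃) ^ l ≠ 0 :=
    mul_ne_zero (mul_ne_zero (sub_ne_zero.2 hz₁) (sub_ne_zero.2 hz₂))
      (pow_ne_zero _ (sub_ne_zero.2 hz₃))
  field_simp

/-- **`((s−1)/s)·H ∈ ℍ²`** for the Fourier partner `H(s) = Q(1−s)/Γ_ℝ(s)` (same lemma at the reflected roots
`1 − zᵢ`, which lie in the open strip as well). [cite: Burnol2004b, Prop. 6.5 proof and Prop. 4.2 proof (arXiv:math/0203120v7 pp. 8, 16; TeX l.695–698, 1322–1328)] -/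
theorem exists_isHardyRight_H (hQ : Differentiable ℂ Q)
    (hQeq : ∀ s, 2 * riemannXi s = (s - z₁) * (s - z₂) * (s - z₃) ^ l * Q s)
    (h₁ : 0 < z₁.re ∧ z₁.re < 1) (h₂ : 0 < z₂.re ∧ z₂.re < 1) (h₃ : 0 < z₃.re ∧ z₃.re < 1)
    (hl : 1 ≤ l) :
    ∃ F : ℂ → ℂ, IsHardyRight F ∧ ∀ s : ℂ, 1 / 2 < s.re → s ≠ 1 →
      F s = ((1 : ℝ) : ℂ) ^ s * ((s - 1) / s) * (Q (1 - s) * (Gammaℝ s)⁻¹) := by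
  obtain ⟨F, hF, hFeq⟩ := BurnolZetaHardy.exists_isHardyRight_zeta_div
  have hHd : Differentiable ℂ (fun s ↦ Q (1 - s) * (Gammaℝ s)⁻¹) :=
    (hQ.comp ((differentiable_const _).sub differentiable_id)).mul differentiable_Gammaℝ_inv
  have hHd' : Differentiable ℂ (fun s ↦ (-1) ^ l * (Q (1 - s) * (Gammaℝ s)⁻¹)) := hHd.const_mul _
  have h₁' : 0 < (1 - z₁).re ∧ (1 - z₁).re < 1 := by
    simp only [Complex.sub_re, Complex.one_re]; constructor <;> linarith [h₁.1, h₁.2]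
  have h₂' : 0 < (1 - z₂).re ∧ (1 - z₂).re < 1 := by
    simp only [Complex.sub_re, Complex.one_re]; constructor <;> linarith [h₂.1, h₂.2]
  have h₃' : 0 < (1 - z₃).re ∧ (1 - z₃).re < 1 := by
    simp only [Complex.sub_re, Complex.one_re]; constructor <;> linarith [h₃.1, h₃.2]
  -- `G₂ = (−1)^l ((s−1)/s) H` is in `ℍ²` by the rational-multiple lemma at the reflected roots
  have hG₂ : IsHardyRight (fun s ↦ (s - 1) / s * ((-1) ^ l * (Q (1 - s) * (Gammaℝ s)⁻¹))) := by
    refine isHardyRight_of_rational hF hFeq (differentiableOn_normalised hHd' fun s hs h ↦ by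
        rw [h] at hs; norm_num at hs)
      ((differentiableOn_normalised hHd' fun s hs h ↦ by
        rw [h] at hs; norm_num at hs).continuousOn)
      (by simp) h₁' h₂' h₃' hl fun s hs hs1 hz₁ hz₂ hz₃ ↦ ?_
    have hs0 : s ≠ 0 := fun h ↦ by rw [h, Complex.zero_re] at hs; norm_num at hs
    have hΓ : Gammaℝ s ≠ 0 := Gammaℝ_ne_zero_of_re_pos (by linarith)
    show (s - 1) / s * ((-1) ^ l * (Q (1 - s) * (Gammaℝ s)⁻¹)) = _
    rw [H_eq (H := fun s ↦ Q (1 - s) * (Gammaℝ s)⁻¹) hQeq (fun _ ↦ rfl) hs0 hs1 hΓ hz₁ hz₂ hz₃]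
    have hP : (s - (1 - z₁)) * (s - (1 - z₂)) * (s - (1 - z₃)) ^ l ≠ 0 :=
      mul_ne_zero (mul_ne_zero (sub_ne_zero.2 hz₁) (sub_ne_zero.2 hz₂))
        (pow_ne_zero _ (sub_ne_zero.2 hz₃))
    field_simp
  refine ⟨fun s ↦ (s - 1) / s * (Q (1 - s) * (Gammaℝ s)⁻¹), ?_, fun s hs hs1 ↦ by
    push_cast; rw [one_cpow, one_mul]⟩
  refine (hG₂.const_mul ((-1) ^ l)).congr fun s _ ↦ ?_
  show (s - 1) / s * (Q (1 - s) * (Gammaℝ s)⁻¹) =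
    (-1) ^ l * ((s - 1) / s * ((-1) ^ l * (Q (1 - s) * (Gammaℝ s)⁻¹)))
  have hm : ((-1 : ℂ)) ^ l * (-1) ^ l = 1 := by rw [← mul_pow]; norm_num
  linear_combination (-(((s - 1) / s * (Q (1 - s) * (Gammaℝ s)⁻¹)))) * hm

/-- **The vectors `w` of `K_1` with `ŵ = W = Q/Γ_ℝ`** ("easily seen to be the right Mellin transforms of
elements from the Sonine space `K_1`"): by the repaired Prop. 4.1 (ii) (`Burnol2004b_prop4_1R_ii`, the
Paley–Wiener door) from the two `ℍ²`-memberships and the functional equation, then `K_1`-membership from the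
absence of a pole at `s = 1` (`BurnolSonineHardy.mem_sonineK_of_continuousAt`).
[cite: Burnol2004b, Prop. 6.5 proof (arXiv:math/0203120v7 p. 16, TeX l.1322–1328)] -/
theorem exists_mem_sonineK (hQ : Differentiable ℂ Q)
    (hQeq : ∀ s, 2 * riemannXi s = (s - z₁) * (s - z₂) * (s - z₃) ^ l * Q s)
    (h₁ : 0 < z₁.re ∧ z₁.re < 1) (h₂ : 0 < z₂.re ∧ z₂.re < 1) (h₃ : 0 < z₃.re ∧ z₃.re < 1)
    (hl : 1 ≤ l) :
    ∃ w ∈ sonineK 1, Set.EqOn (rightMellinExt w) (fun s ↦ Q s * (Gammaℝ s)⁻¹) {s | s ≠ 1} := by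
  set W : ℂ → ℂ := fun s ↦ Q s * (Gammaℝ s)⁻¹ with hWdef
  set H : ℂ → ℂ := fun s ↦ Q (1 - s) * (Gammaℝ s)⁻¹ with hHdef
  have hWd : Differentiable ℂ W := differentiable_of_eq_mul_Gammaℝ_inv hQ (W := W) fun _ ↦ rfl
  have hHd : Differentiable ℂ H := differentiable_of_eq_comp_mul_Gammaℝ_inv hQ (H := H) fun _ ↦ rfl
  have hFE := Gammaℝ_mul_H_eq (Q := Q) (W := W) (H := H) (fun _ ↦ rfl) (fun _ ↦ rfl)
  obtain ⟨f, hfL, hfeq⟩ := Burnol2004b_prop4_1R_ii 1 one_pos W H hWd.differentiableOn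
    hHd.differentiableOn hFE (exists_isHardyRight_W hQ hQeq h₁ h₂ h₃ hl)
    (exists_isHardyRight_H hQ hQeq h₁ h₂ h₃ hl)
  -- the continuation `rightMellinExt f` IS `W` off `s = 1`
  have hcont := hasRightMellinContinuation_rightMellinExt_of_mem_sonineL one_pos hfL
  have hW' : HasRightMellinContinuation f W := ⟨hWd.differentiableOn, fun s hs hs' ↦ (hfeq s hs hs').symm⟩
  have hext : Set.EqOn (rightMellinExt f) W {s | s ≠ 1} := hcont.eqOn hW'
  refine ⟨f, ?_, hext⟩
  -- `K_1`-membership: no pole at `1` on either side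
  refine BurnolSonineHardy.mem_sonineK_of_continuousAt one_pos hfL (G := W) hWd.continuous.continuousAt
    (fun s hs hs' ↦ (hfeq s hs hs').symm) (H := H) hHd.continuous.continuousAt fun s hs hs' ↦ ?_
  -- the Fourier side on the strip through the functional equation
  have hFf := fourier_mem_sonineL hfL
  have hcF := hasRightMellinContinuation_rightMellinExt_of_mem_sonineL one_pos hFf
  have hs0 : ∀ n : ℕ, s ≠ -2 * (n : ℂ) := fun n h ↦ by
    have := congrArg Complex.re h; simp at this; linarith
  have hs1 : ∀ n : ℕ, s ≠ 1 + 2 * (n : ℂ) := fun n h ↦ by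
    have := congrArg Complex.re h; simp at this; linarith
  have hΓ : Gammaℝ s ≠ 0 := Gammaℝ_ne_zero_of_re_pos (by linarith)
  have hΓ' : Gammaℝ (1 - s) ≠ 0 := Gammaℝ_ne_zero_of_re_pos (by simp; linarith)
  have hne : (1 - s) ∈ {s : ℂ | s ≠ 1} := by
    simp only [Set.mem_setOf_eq, ne_eq, sub_eq_self]
    intro h; rw [h, Complex.zero_re] at hs; norm_num at hs
  have hfe := SonineLContinuation.rightMellinExt_functionalEquation_of_mem_sonineL one_pos hfL s hs0 hs1
  rw [hext hne] at hfe
  rw [← hcF.2 s hs hs']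
  have : rightMellinExt (𝓕 f : Lp ℂ 2 (volume : Measure ℝ)) s =
      (Gammaℝ s)⁻¹ * (Gammaℝ (1 - s) * W (1 - s)) := by
    rw [← hfe]; field_simp
  rw [this, hHdef, hWdef]
  simp only
  field_simp

/-- `{s | Γ_ℝ(s) ≠ 0}` is open (`1/Γ_ℝ` is entire). [folklore] -/
private theorem isOpen_Gammaℝ_ne_zero : IsOpen {s : ℂ | Gammaℝ s ≠ 0} := by
  have : {s : ℂ | Gammaℝ s ≠ 0} = (fun s : ℂ ↦ (Gammaℝ s)⁻¹) ⁻¹' {0}ᶜ := by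
    ext s; simp
  rw [this]
  exact isOpen_compl_singleton.preimage differentiable_Gammaℝ_inv.continuous

/-- **The pairings with the evaluators**: for `w ∈ K_1` with `ŵ = Q/Γ_ℝ` off `s = 1`, and every index
`(ρ′, k)`, `[w, Z¹_{ρ′,k}] = M(w)^{(k)}(ρ′) = Q^{(k)}(ρ′)` (the completed transform `Γ_ℝ·ŵ` is `Q` near `ρ′`).
[cite: Burnol2004b, Prop. 6.5 proof and §2 (arXiv:math/0203120v7 pp. 5, 16; TeX l.481–484, 1322–1328)] -/
theorem setIntegral_mul_burnolZ_eq_iteratedDeriv {w : Lp ℂ 2 (volume : Measure ℝ)}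
    (hwK : w ∈ sonineK 1) (hext : Set.EqOn (rightMellinExt w) (fun s ↦ Q s * (Gammaℝ s)⁻¹) {s | s ≠ 1})
    (r : ZetaZeroIndex) :
    ∫ t in Ioi (0 : ℝ), w t * burnolZ 1 r.1.1 r.1.2 t = iteratedDeriv r.1.2 Q r.1.1 := by
  obtain ⟨h0, h1, hn⟩ := BurnolEvaluators.admissible_of_mem_nontrivialZeros r.2.1
  obtain ⟨-, hρ0, -⟩ := mem_riemannZetaNontrivialZeros_iff_holds.1 r.2.1
  rw [BurnolEvaluators.setIntegral_mul_burnolZ one_pos h0 h1 hn _ hwK]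
  have hΓρ : Gammaℝ r.1.1 ≠ 0 := Gammaℝ_ne_zero_of_re_pos hρ0
  have hev : completedMellin (w : ℝ → ℂ) =ᶠ[𝓝 r.1.1] Q := by
    filter_upwards [isOpen_ne.mem_nhds h1, isOpen_Gammaℝ_ne_zero.mem_nhds hΓρ] with s hs hΓ
    show Gammaℝ s * rightMellinExt w s = Q s
    rw [hext hs]
    field_simp
  show iteratedDeriv r.1.2 (completedMellin (w : ℝ → ℂ)) r.1.1 = _
  exact hev.iteratedDeriv_eq _

end Vectors

/-! ## F. Orders of `Q` at the zeros and the (non-)vanishing of the pairings -/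

/-- From `ord(2ξ) = ord Q + c` at a point of the strip: `ord Q = m − c`. [cite: Burnol2004b, Prop. 6.5 proof (arXiv:math/0203120v7 p. 16, TeX l.1322–1328)] -/
theorem analyticOrderAt_eq_sub {Q : ℂ → ℂ} {ρ : ℂ} (h0 : 0 < ρ.re) (h1 : ρ.re < 1) {c : ℕ}
    (hord : analyticOrderAt (fun s ↦ 2 * riemannXi s) ρ = analyticOrderAt Q ρ + c) :
    analyticOrderAt Q ρ = ((riemannZetaZeroOrder ρ).toNat - c : ℕ) := by
  rw [analyticOrderAt_two_mul_riemannXi h0 h1] at hord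
  have hne : analyticOrderAt Q ρ ≠ ⊤ := by
    intro h; rw [h, top_add] at hord; exact ENat.coe_ne_top _ hord
  obtain ⟨n, hn⟩ := ENat.ne_top_iff_exists.mp hne
  rw [← hn] at hord ⊢
  have : (riemannZetaZeroOrder ρ).toNat = n + c := by exact_mod_cast hord
  congr 1
  omega

/-- The count of `z` in the root list `ρ₁ :: ρ₂ :: [ρ, …, ρ]` (`l` copies of `ρ`). [folklore] -/
private theorem count_roots (ρ₁ ρ₂ ρ z : ℂ) (l : ℕ) :
    (ρ₁ :: ρ₂ :: List.replicate l ρ).count z =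
      (if ρ = z then l else 0) + (if ρ₂ = z then 1 else 0) + (if ρ₁ = z then 1 else 0) := by
  simp only [List.count_cons, List.count_replicate, beq_iff_eq]

/-- The product over the root list. [folklore] -/
private theorem prod_roots (ρ₁ ρ₂ ρ s : ℂ) (l : ℕ) :
    ((ρ₁ :: ρ₂ :: List.replicate l ρ).map fun z ↦ s - z).prod = (s - ρ₁) * (s - ρ₂) * (s - ρ) ^ l := by
  simp only [List.map_cons, List.prod_cons, List.map_replicate, List.prod_replicate]
  ring

/-! ## G. Prop. 6.5, minimality of the shortened system -/

/-- For a non-trivial zero, `m(ρ)` as a natural number casts back to `riemannZetaZeroOrder ρ`. [cite: Burnol2004b, Note 5 (arXiv:math/0203120v7 p. 11, TeX l.978–984)] -/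
theorem toNat_riemannZetaZeroOrder {ρ : ℂ} (h0 : 0 < ρ.re) (h1 : ρ.re < 1) :
    ((riemannZetaZeroOrder ρ).toNat : ℤ) = riemannZetaZeroOrder ρ := by
  rw [riemannZetaZeroOrder_eq_analyticOrderNatAt_riemannXi' h0 h1, Int.toNat_natCast]

/-- The index bound of a member of the system: `k < m(ρ)`. [cite: Burnol2004b, §2 (arXiv:math/0203120v7 p. 5, TeX l.486–491)] -/
theorem ZetaZeroIndex.lt_toNat (r : ZetaZeroIndex) : r.1.2 < (riemannZetaZeroOrder r.1.1).toNat := by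
  obtain ⟨-, h0, h1⟩ := mem_riemannZetaNontrivialZeros_iff_holds.1 r.2.1
  have h := r.2.2
  rw [← toNat_riemannZetaZeroOrder h0 h1] at h
  exact_mod_cast h

/-- **The remaining indices after an admissible omission**: if `r = (ρ′, k)` is neither `p` nor `q`, then
`k + [ρ′ = ρ_p] + [ρ′ = ρ_q] < m(ρ′)` — at `ρ_p` (resp. `ρ_q`) only the top index was removed (both top
indices when `ρ_p = ρ_q`). [cite: Burnol2004b, Prop. 6.5 (arXiv:math/0203120v7 p. 16, TeX l.1303–1310)] -/
theorem remaining_index_lt {p q : ZetaZeroIndex} (hpq : IsAdmissibleOmission p q) (r : ZetaZeroIndex)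
    (hrp : r ≠ p) (hrq : r ≠ q) :
    r.1.2 + ((if q.1.1 = r.1.1 then 1 else 0) + (if p.1.1 = r.1.1 then 1 else 0)) <
      (riemannZetaZeroOrder r.1.1).toNat := by
  obtain ⟨hpq0, hp, hq⟩ := hpq
  obtain ⟨-, hr0, hr1⟩ := mem_riemannZetaNontrivialZeros_iff_holds.1 r.2.1
  obtain ⟨-, hp0, hp1⟩ := mem_riemannZetaNontrivialZeros_iff_holds.1 p.2.1
  obtain ⟨-, hq0, hq1⟩ := mem_riemannZetaNontrivialZeros_iff_holds.1 q.2.1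
  have hrk := ZetaZeroIndex.lt_toNat r
  have hpk : p.1.2 + 1 = (riemannZetaZeroOrder p.1.1).toNat := by
    have := toNat_riemannZetaZeroOrder hp0 hp1; omega
  -- `r` differs from `p` and `q` as pairs
  have hne_p : r.1 ≠ p.1 := fun h ↦ hrp (Subtype.ext h)
  have hne_q : r.1 ≠ q.1 := fun h ↦ hrq (Subtype.ext h)
  by_cases hpr : p.1.1 = r.1.1
  · -- at `ρ_p`: `k ≠ m − 1`
    have hkp : r.1.2 ≠ p.1.2 := fun h ↦ hne_p (Prod.ext hpr.symm h)
    rw [hpr] at hpk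
    by_cases hqr : q.1.1 = r.1.1
    · -- `ρ_q = ρ_p`: also `k ≠ m − 2`
      have hkq : r.1.2 ≠ q.1.2 := fun h ↦ hne_q (Prod.ext hqr.symm h)
      rcases hq with ⟨hqp, hq2⟩ | ⟨hqp, _⟩
      · have hqk : q.1.2 + 2 = (riemannZetaZeroOrder r.1.1).toNat := by
          rw [← hqr]; have := toNat_riemannZetaZeroOrder hq0 hq1; omega
        simp only [hpr, hqr, if_true]
        omega
      · exact absurd (hqr.trans hpr.symm) hqp
    · simp only [hqr, hpr, if_false, if_true, zero_add]
      omega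
  · by_cases hqr : q.1.1 = r.1.1
    · have hkq : r.1.2 ≠ q.1.2 := fun h ↦ hne_q (Prod.ext hqr.symm h)
      rcases hq with ⟨hqp, _⟩ | ⟨_, hq1'⟩
      · exact absurd (hqp.symm.trans hqr) hpr
      · have hqk : q.1.2 + 1 = (riemannZetaZeroOrder r.1.1).toNat := by
          rw [← hqr]; have := toNat_riemannZetaZeroOrder hq0 hq1; omega
        simp only [hqr, hpr, if_true, if_false, add_zero]
        omega
    · simp only [hqr, hpr, if_false, add_zero]
      exact hrk

/-- The multiplicity at `ρ_p` is at least `1 + [ρ_q = ρ_p]` (the omitted indices exist).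
[cite: Burnol2004b, Prop. 6.5 (arXiv:math/0203120v7 p. 16, TeX l.1303–1310)] -/
theorem count_le_at_p {p q : ZetaZeroIndex} (hpq : IsAdmissibleOmission p q) :
    (if q.1.1 = p.1.1 then 1 else 0) + 1 ≤ (riemannZetaZeroOrder p.1.1).toNat := by
  obtain ⟨-, hp, hq⟩ := hpq
  obtain ⟨-, hp0, hp1⟩ := mem_riemannZetaNontrivialZeros_iff_holds.1 p.2.1
  obtain ⟨-, hq0, hq1⟩ := mem_riemannZetaNontrivialZeros_iff_holds.1 q.2.1
  have hpk : p.1.2 + 1 = (riemannZetaZeroOrder p.1.1).toNat := by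
    have := toNat_riemannZetaZeroOrder hp0 hp1; omega
  by_cases hqp : q.1.1 = p.1.1
  · rcases hq with ⟨_, hq2⟩ | ⟨hqp', _⟩
    · have hqk : q.1.2 + 2 = (riemannZetaZeroOrder p.1.1).toNat := by
        rw [← hqp]; have := toNat_riemannZetaZeroOrder hq0 hq1; omega
      simp only [hqp, if_true]; omega
    · exact absurd hqp hqp'
  · simp only [hqp, if_false]; omega

/-- Symmetric form at `ρ_q`. [cite: Burnol2004b, Prop. 6.5 (arXiv:math/0203120v7 p. 16, TeX l.1303–1310)] -/
theorem count_le_at_q {p q : ZetaZeroIndex} (hpq : IsAdmissibleOmission p q) :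
    1 + (if p.1.1 = q.1.1 then 1 else 0) ≤ (riemannZetaZeroOrder q.1.1).toNat := by
  by_cases hqp : p.1.1 = q.1.1
  · have h := count_le_at_p hpq
    simp only [hqp, if_true] at h ⊢
    rw [← hqp]; simpa [hqp] using h
  · obtain ⟨-, _, hq⟩ := hpq
    obtain ⟨-, hq0, hq1⟩ := mem_riemannZetaNontrivialZeros_iff_holds.1 q.2.1
    rcases hq with ⟨hqp', _⟩ | ⟨_, hq1'⟩
    · exact absurd hqp'.symm hqp
    · have hqk : q.1.2 + 1 = (riemannZetaZeroOrder q.1.1).toNat := by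
        have := toNat_riemannZetaZeroOrder hq0 hq1; omega
      simp only [hqp, if_false]; omega

/-- **Burnol 2004b, Prop. 6.5 — minimality of the shortened system.** "To prove minimality for the shortened
system one only has to consider the functions `s(s−1)ζ(s)/((s−ρ₁)(s−ρ₂))·1/(s−ρ)^l` associated with the
remaining zeros (and remaining multiplicities), as they are easily seen to be the right Mellin transforms of
elements from the Sonine space `K_1`": for an admissible pair `p, q` of omitted indices, the system
`(Z¹_{ρ,k})_{(ρ,k) ≠ p, q}` is minimal. The dual vectors are the `w_{ρ,l} ∈ K_1`
(`exists_mem_sonineK`), their pairings `[w_{ρ,l}, Z¹_{ρ′,k}] = Q_{ρ,l}^{(k)}(ρ′)` vanish for `ρ′ ≠ ρ` and for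
`k + l < m′_ρ` and do not vanish for `k + l = m′_ρ` (`m′_ρ` = number of remaining indices at `ρ`), and the
triangular inversion is `BurnolZetaMinimal.exists_dual_functional`.
[cite: Burnol2004b, Prop. 6.5 (arXiv:math/0203120v7 p. 16, TeX l.1303–1328)] -/
theorem isMinimalSystem_shortened (p q : ZetaZeroIndex) (hpq : IsAdmissibleOmission p q) :
    IsMinimalSystem (fun r : {r : ZetaZeroIndex // r ≠ p ∧ r ≠ q} ↦ burnolZSystem 1 r.1) := by
  classical
  intro r₀ hmem
  obtain ⟨⟨⟨ρ, k₀⟩, hρ, hk₀⟩, hr₀p, hr₀q⟩ := r₀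
  obtain ⟨-, hρ0, hρ1⟩ := mem_riemannZetaNontrivialZeros_iff_holds.1 hρ
  obtain ⟨-, hp0, hp1⟩ := mem_riemannZetaNontrivialZeros_iff_holds.1 p.2.1
  obtain ⟨-, hq0, hq1⟩ := mem_riemannZetaNontrivialZeros_iff_holds.1 q.2.1
  -- the number `cρ` of omitted indices at `ρ` and the number `m'` of remaining ones
  obtain ⟨cρ, hcρ⟩ : ∃ cρ : ℕ, cρ = (if q.1.1 = ρ then 1 else 0) + (if p.1.1 = ρ then 1 else 0) :=
    ⟨_, rfl⟩
  have hk₀' : k₀ + cρ < (riemannZetaZeroOrder ρ).toNat := by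
    rw [hcρ]; exact remaining_index_lt hpq ⟨(ρ, k₀), hρ, hk₀⟩ hr₀p hr₀q
  obtain ⟨m', hm'⟩ : ∃ m' : ℕ, m' = (riemannZetaZeroOrder ρ).toNat - cρ := ⟨_, rfl⟩
  have hk₀m : k₀ < m' := by omega
  -- the dual vectors `w_l ∈ K_1`, `1 ≤ l ≤ m'`, with `ŵ_l = Q_l/Γ_ℝ`, `2ξ = (s−ρ_p)(s−ρ_q)(s−ρ)^l Q_l`
  have hw : ∀ l, 1 ≤ l → l ≤ m' → ∃ Q : ℂ → ℂ, ∃ w : Lp ℂ 2 (volume : Measure ℝ),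
      Differentiable ℂ Q ∧ w ∈ sonineK 1 ∧
      (∀ z, analyticOrderAt (fun s ↦ 2 * riemannXi s) z =
        analyticOrderAt Q z + (p.1.1 :: q.1.1 :: List.replicate l ρ).count z) ∧
      Set.EqOn (rightMellinExt w) (fun s ↦ Q s * (Gammaℝ s)⁻¹) {s | s ≠ 1} := by
    intro l hl1 hlm
    have hL : ∀ z, ((p.1.1 :: q.1.1 :: List.replicate l ρ).count z : ℕ∞) ≤
        analyticOrderAt (fun s ↦ 2 * riemannXi s) z := by
      intro z
      by_cases hz : ρ = z ∨ q.1.1 = z ∨ p.1.1 = z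
      · obtain ⟨hz0, hz1⟩ : 0 < z.re ∧ z.re < 1 := by
          rcases hz with h | h | h <;> rw [← h]
          exacts [⟨hρ0, hρ1⟩, ⟨hq0, hq1⟩, ⟨hp0, hp1⟩]
        rw [analyticOrderAt_two_mul_riemannXi hz0 hz1, count_roots]
        have hnat : (if ρ = z then l else 0) + (if q.1.1 = z then 1 else 0) +
            (if p.1.1 = z then 1 else 0) ≤ (riemannZetaZeroOrder z).toNat := by
          by_cases h1 : ρ = z
          · subst h1
            simp only [if_true]
            omega
          · simp only [h1, if_false, zero_add]
            by_cases h2 : q.1.1 = z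
            · subst h2
              simp only [if_true]
              exact count_le_at_q hpq
            · simp only [h2, if_false, zero_add]
              by_cases h3 : p.1.1 = z
              · subst h3
                simp only [if_true]
                have := count_le_at_p hpq
                omega
              · simp [h3]
        exact_mod_cast hnat
      · simp only [not_or] at hz
        rw [count_roots]
        simp [hz.1, hz.2.1, hz.2.2]
    obtain ⟨Q, hQ, hQeq, hord⟩ := exists_eq_prod_mul _ differentiable_two_mul_riemannXi _ hL
    have hQeq' : ∀ s, 2 * riemannXi s = (s - p.1.1) * (s - q.1.1) * (s - ρ) ^ l * Q s := fun s ↦ by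
      rw [hQeq s, prod_roots]
    obtain ⟨w, hwK, hext⟩ := exists_mem_sonineK hQ hQeq' ⟨hp0, hp1⟩ ⟨hq0, hq1⟩ ⟨hρ0, hρ1⟩ hl1
    exact ⟨Q, w, hQ, hwK, hord, hext⟩
  choose! Qf wf hQf hwK hordf hextf using hw
  -- orders of `Q_l` at the zeros
  have hordρ : ∀ l, 1 ≤ l → l ≤ m' → analyticOrderAt (Qf l) ρ = ((m' - l : ℕ) : ℕ∞) := by
    intro l hl1 hlm
    have h := analyticOrderAt_eq_sub hρ0 hρ1 (hordf l hl1 hlm ρ)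
    rw [h, count_roots]
    simp only [if_true]
    congr 1
    omega
  have hordne : ∀ l, 1 ≤ l → l ≤ m' → ∀ r : ZetaZeroIndex, r.1.1 ≠ ρ → r ≠ p → r ≠ q →
      (r.1.2 : ℕ∞) < analyticOrderAt (Qf l) r.1.1 := by
    intro l hl1 hlm r hrρ hrp hrq
    obtain ⟨-, hr0, hr1⟩ := mem_riemannZetaNontrivialZeros_iff_holds.1 r.2.1
    have h := analyticOrderAt_eq_sub hr0 hr1 (hordf l hl1 hlm r.1.1)
    rw [h, count_roots]
    have hρr : ¬ ρ = r.1.1 := fun e ↦ hrρ e.symm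
    simp only [hρr, if_false, zero_add]
    have := remaining_index_lt hpq r hrp hrq
    exact_mod_cast (by omega : r.1.2 < (riemannZetaZeroOrder r.1.1).toNat -
      ((if q.1.1 = r.1.1 then 1 else 0) + (if p.1.1 = r.1.1 then 1 else 0)))
  -- the pairing functionals `φ_k = [·, w_{k+1}]`
  choose T hT using fun k : ℕ ↦ BurnolZetaMinimal.exists_pairingCLM (wf (k + 1))
  -- their values on the evaluators: `[Z¹_{ρ′,k′}, w_{k+1}] = Q_{k+1}^{(k′)}(ρ′)`
  have hTZ : ∀ k, k + 1 ≤ m' → ∀ r : ZetaZeroIndex,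
      T k (burnolZ 1 r.1.1 r.1.2) = iteratedDeriv r.1.2 (Qf (k + 1)) r.1.1 := by
    intro k hk r
    rw [hT, ← setIntegral_mul_burnolZ_eq_iteratedDeriv (hwK (k + 1) (by omega) hk)
      (hextf (k + 1) (by omega) hk) r]
    exact integral_congr_ae (Eventually.of_forall fun t ↦ mul_comm _ _)
  -- the triangular pattern at `ρ`
  have hidx : ∀ l, 1 ≤ l → l ≤ m' → ((l - 1 : ℕ) : ℤ) < riemannZetaZeroOrder ρ := by
    intro l hl1 hlm
    rw [← toNat_riemannZetaZeroOrder hρ0 hρ1]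
    exact_mod_cast (by omega : l - 1 < (riemannZetaZeroOrder ρ).toNat)
  have h0 : ∀ k l, 1 ≤ l → l ≤ m' → k + l < m' → T k (burnolZ 1 ρ (l - 1)) = 0 := by
    intro k l hl1 hlm hkl
    have hk : k + 1 ≤ m' := by omega
    rw [hTZ k hk ⟨(ρ, l - 1), hρ, hidx l hl1 hlm⟩]
    show iteratedDeriv (l - 1) (Qf (k + 1)) ρ = 0
    have hQa := (hQf (k + 1) (by omega) hk).analyticAt ρ
    have ho := hordρ (k + 1) (by omega) hk
    exact ((analyticOrderAt_eq_nat_iff_iteratedDeriv_eq_zero hQa).1 ho).1 (l - 1) (by omega)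
  have h1 : ∀ k l, 1 ≤ l → l ≤ m' → k + l = m' → T k (burnolZ 1 ρ (l - 1)) ≠ 0 := by
    intro k l hl1 hlm hkl
    have hk : k + 1 ≤ m' := by omega
    rw [hTZ k hk ⟨(ρ, l - 1), hρ, hidx l hl1 hlm⟩]
    show iteratedDeriv (l - 1) (Qf (k + 1)) ρ ≠ 0
    have hQa := (hQf (k + 1) (by omega) hk).analyticAt ρ
    have ho := hordρ (k + 1) (by omega) hk
    have heq : m' - (k + 1) = l - 1 := by omega
    rw [heq] at ho
    exact ((analyticOrderAt_eq_nat_iff_iteratedDeriv_eq_zero hQa).1 ho).2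
  obtain ⟨ψ, hψ0, hψ1, hψ2⟩ := BurnolZetaMinimal.exists_dual_functional T
    (fun l ↦ burnolZ 1 ρ (l - 1)) m' h0 h1 (k₀ + 1) (by omega) (by omega)
  simp only [Nat.add_sub_cancel] at hψ0
  -- `ψ` kills every other vector of the shortened system
  have hker : ∀ r : {r : ZetaZeroIndex // r ≠ p ∧ r ≠ q},
      r ≠ ⟨⟨(ρ, k₀), hρ, hk₀⟩, hr₀p, hr₀q⟩ → ψ (burnolZSystem 1 r.1) = 0 := by
    rintro ⟨⟨⟨ρ', k⟩, hρ', hk⟩, hrp, hrq⟩ hr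
    show ψ (burnolZ 1 ρ' k) = 0
    by_cases heq : ρ' = ρ
    · subst heq
      have hkk : k ≠ k₀ := by
        intro h; apply hr; subst h; rfl
      have hkm : k < m' := by
        have := remaining_index_lt hpq ⟨(ρ', k), hρ', hk⟩ hrp hrq
        simp only at this
        omega
      have := hψ1 (k + 1) (by omega) (by omega) (by omega)
      simpa using this
    · refine hψ2 _ fun k' hk' ↦ ?_
      rw [hTZ k' (by omega) ⟨(ρ', k), hρ', hk⟩]
      show iteratedDeriv k (Qf (k' + 1)) ρ' = 0
      have hQa := (hQf (k' + 1) (by omega) (by omega)).analyticAt ρ'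
      have hlt := hordne (k' + 1) (by omega) (by omega) ⟨(ρ', k), hρ', hk⟩ heq hrp hrq
      exact (natCast_le_analyticOrderAt_iff_iteratedDeriv_eq_zero hQa).1 (Order.add_one_le_of_lt hlt)
        k (by simp)
  -- hence the closed span of the others lies in `ker ψ`, which misses `Z¹_{ρ,k₀}`
  have hspan : (Submodule.span ℂ ((fun r : {r : ZetaZeroIndex // r ≠ p ∧ r ≠ q} ↦ burnolZSystem 1 r.1) ''
      {j | j ≠ ⟨⟨(ρ, k₀), hρ, hk₀⟩, hr₀p, hr₀q⟩}) : Set (Lp ℂ 2 (volume : Measure ℝ))) ⊆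
      {x | ψ x = 0} := by
    have : Submodule.span ℂ ((fun r : {r : ZetaZeroIndex // r ≠ p ∧ r ≠ q} ↦ burnolZSystem 1 r.1) ''
        {j | j ≠ ⟨⟨(ρ, k₀), hρ, hk₀⟩, hr₀p, hr₀q⟩}) ≤
        LinearMap.ker (ψ : Lp ℂ 2 (volume : Measure ℝ) →ₗ[ℂ] ℂ) := by
      refine Submodule.span_le.2 ?_
      rintro x ⟨r, hr, rfl⟩
      exact hker r hr
    intro x hx
    exact this hx
  have hcl : closure (Submodule.span ℂ ((fun r : {r : ZetaZeroIndex // r ≠ p ∧ r ≠ q} ↦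
      burnolZSystem 1 r.1) '' {j | j ≠ ⟨⟨(ρ, k₀), hρ, hk₀⟩, hr₀p, hr₀q⟩}) :
      Set (Lp ℂ 2 (volume : Measure ℝ))) ⊆ {x | ψ x = 0} :=
    closure_minimal hspan (isClosed_singleton.preimage ψ.continuous)
  exact hψ0 (hcl hmem)

end BurnolShortened

/-- **Burnol 2004b, Prop. 6.5, last clause — "This shortened system is then a minimal system."** For every
admissible pair `p, q` of omitted indices (`Z¹_{ρ₁,m_{ρ₁}−1}, Z¹_{ρ₂,m_{ρ₂}−1}` with `ρ₁ ≠ ρ₂`, or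
`Z¹_{ρ,m_ρ−1}, Z¹_{ρ,m_ρ−2}`), the system `(Z¹_{ρ,k})_{(ρ,k) ≠ p,q}` of evaluators of `K_1` is minimal — the
third conjunct of the typed `Burnol2004b_prop6_5`, free-standing (`BurnolShortened.isMinimalSystem_shortened`).
[cite: Burnol2004b, Prop. 6.5 (arXiv:math/0203120v7 p. 16, TeX l.1303–1328)] -/
theorem Burnol2004b_prop6_5_minimal (p q : ZetaZeroIndex) (hpq : IsAdmissibleOmission p q) :
    IsMinimalSystem (fun r : {r : ZetaZeroIndex // r ≠ p ∧ r ≠ q} ↦ burnolZSystem 1 r.1) :=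
  BurnolShortened.isMinimalSystem_shortened p q hpq

end Literature.NumberTheory.LFunctions
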